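import Literature.NumberTheory.ComplexMultiplication.CMOrderTraceDualClasses
import Literature.NumberTheory.ComplexMultiplication.CMOrderWeakClassesCount
import Literature.NumberTheory.ComplexMultiplication.CMOrderIdealClassMonoidConductorDivisorSum
import HarnessLib

/-!
# `S` is Gorenstein ⟺ `#W̄k(S) = 1` ⟺ `#ICM_S(R) = #Pic(S)`; a non-Gorenstein over-order has the two distinct weak
# classes `[S] ≠ [Sᵗ]` (Marseglia 2019, §4 remark after Def. 4.2 and §5 first remark, with Thm. 4.6) — any degree

Family `hodge`, lane `lit-hodgefound` (Track 2 foundations library; seat p15, row g25-#5 — the junction of g25-#1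
`CMOrderGorenstein` (PROP. 2.7: Gorenstein ⟺ `Sᵗ` invertible in `S`), g25-#3 `CMOrderTraceDualClasses` («`W̄k(S) = {[S]}`
iff `S` Gorenstein», ideal by ideal) and g25-#4 `CMOrderWeakClassesCount` (THM. 4.6 counted: `#ICM_S = #W̄k(S)·#Pic(S)`)),
topic `Literature/NumberTheory/ComplexMultiplication`.  THEOREMS ONLY: no definition, no instance, no named fact (D-0026,
net Literature debt `0`).

Carriers, BY NAME: §1 for every order `𝔯 = endOrder ρ`; §2 for `𝔬 = endOrder (M_μ)` (any degree) with an over-order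
given as an idempotent `M = MM ≠ 0` whose carrier is the subring `S` (`(M : Set K) = S`); the stratum subtype
`{I // I ≠ 0 ∧ ((I:I) : Set K) = S}` of g24-#2 with the inline `Quot`s `ICM_S` (by `I ∼ xN`), `W̄k(S)` (by
`1 ∈ (I:N)(N:I)`) and `Pic(S)` (the `L·((L:L):L) = (L:L)` part, by `∼`) of g25-#4; «`S` Gorenstein» is the
reflexive form `∀ I ≠ 0, MI = I → (M:(M:I)) = I` of `CMOrderGorenstein`; `Sᵗ` is `↑TM = Submodule.traceDual ℤ ℚ ↑M`.

## Source, VERBATIM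

S. Marseglia, *Computing the ideal class monoid of an order*, J. Lond. Math. Soc. (2) 101 (2020) [Marseglia2019],
held `paper:arxiv-1805.09671`, §4 p. 8 (chunk p0008) and §5 p. 10 (chunk p0010):

> By Proposition 4.1 (b) an ideal is invertible if and only if it is weakly equivalent to its multiplicator ring
> and hence we have that `W̄k(S) = {[S]}` if and only if `S` is Gorenstein.
> (§5) Recall that we can partition `Wk(R)` as the disjoint union of `W̄k(S)` where `S` runs through the set of
> over-orders of `R`. […] Observe that when `S` is not Gorenstein there are always at least two distinct classes in
> `W̄k(S)`, namely `[S]` and `[Sᵗ]`.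

and §4 Thm. 4.6, p. 9: «`W̄k(S) = ICM_S/Pic(S)`» (counted in g25-#4).

## What is formalised

* §1 (ANY order `𝔯`): **`EndOrder.finite_quot_stratum_weak`** (`W̄k(S)` is finite — a quotient of the finite
  `ICM_S(𝔯)`, the tree's `EndOrder.finite_quot_stratum` of g24-#4, REUSED), `EndOrder.natCard_quot_stratum_weak_eq_one_iff`
  (`#W̄k(S) = 1` iff the stratum is nonempty with all members pairwise weakly equivalent).
* §2 (`𝔬 = endOrder (M_μ)`): `coe_div_self_eq_iff_div_self_eq` (bookkeeping), **`natCard_quot_stratum_weak_eq_one_iff_forall_div_div_eq`**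
  («`W̄k(S) = {[S]}` iff `S` is Gorenstein», COUNTED), **`one_mem_traceDual_div_mul_div_iff_forall_div_div_eq`** (`Sᵗ ~ S`
  iff `S` Gorenstein), **`two_le_natCard_quot_stratum_weak_of_not_forall_div_div_eq`** («at least two distinct classes
  in `W̄k(S)`, namely `[S]` and `[Sᵗ]`»), **`natCard_quot_stratum_eq_natCard_quot_pic_iff_forall_div_div_eq`**
  (`#ICM_S(𝔯) = #Pic(S)` ⟺ `S` Gorenstein — the any-degree form of g24-#2's quadratic count `#ICM_S = #ClassGroup S`).

NOT formalised: the monoid structure of `Wk(R)`; §5's Prop. 5.1 / Remark 5.4 (representatives `𝔣 ⊆ I ⊆ T`).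

## References
* [Marseglia2019] S. Marseglia, *Computing the ideal class monoid of an order*, J. Lond. Math. Soc. (2) 101 (2020)
  984–1007, §4 (after Def. 4.2), Thm. 4.6, pp. 8–9; §5 (first remark), p. 10. [cite: Marseglia2019, §5, p. 10]
* [BuchmannLenstra1994] J. A. Buchmann, H. W. Lenstra, Jr., *Approximating rings of integers in number fields*,
  J. Théor. Nombres Bordeaux 6 (1994) 221–260, §2 Prop. 2.7, p. 230. [cite: BuchmannLenstra1994, §2 Prop. 2.7, p. 230]
* [DadeTausskyZassenhaus1962] E. C. Dade, O. Taussky, H. Zassenhaus, Math. Ann. 148 (1962) 31–64.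
  [cite: DadeTausskyZassenhaus1962, §1]
-/

noncomputable section

open scoped nonZeroDivisors NumberField Pointwise
open NumberField Module FractionalIdeal
open Submodule (traceDual)

namespace Literature.NumberTheory.ComplexMultiplication

namespace EndOrder

section AnyOrder

variable {K : Type} [Field K] [NumberField K]
variable {ι : Type} [Fintype ι] [DecidableEq ι] [Nonempty ι] {ρ : K →ₐ[ℚ] Matrix ι ι ℚ}
variable [IsFractionRing (endOrder ρ) K]

/-! ## §1 `W̄k(S)` is finite (`ICM_S(𝔯)` is: `CMOrderIdealClassMonoidConductorDivisorSum.finite_quot_stratum`);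
`#W̄k(S) = 1` iff all ideals of the stratum are weakly equivalent -/

/-- **`W̄k(S)` is finite** (a quotient of `ICM_S(𝔯)`: isomorphic ideals are weakly equivalent).
[cite: Marseglia2019, §4 Def. 4.2 and Thm. 4.6 («`W̄k(S) = ICM_S/Pic(S)`»), pp. 8–9] -/
theorem finite_quot_stratum_weak (S : Subring K) :
    Finite (Quot fun M N : {M : FractionalIdeal (endOrder ρ)⁰ K //
        M ≠ 0 ∧ ((M / M : FractionalIdeal (endOrder ρ)⁰ K) : Set K) = S} =>
      (1 : K) ∈ (M : FractionalIdeal (endOrder ρ)⁰ K) / N * (N / M)) := by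
  haveI := finite_quot_stratum (ρ := ρ) (K := K) S
  refine Finite.of_surjective (α := Quot fun M N : {M : FractionalIdeal (endOrder ρ)⁰ K //
        M ≠ 0 ∧ ((M / M : FractionalIdeal (endOrder ρ)⁰ K) : Set K) = S} =>
      ∃ x : K, x ≠ 0 ∧ (M : FractionalIdeal (endOrder ρ)⁰ K) = spanSingleton (endOrder ρ)⁰ x * N)
    (Quot.lift (fun M => Quot.mk _ M) fun M N h => Quot.sound (by
      obtain ⟨x, hx, h⟩ := h
      exact one_mem_div_mul_div_of_eq_spanSingleton_mul hx N.2.1 h)) fun q => ?_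
  induction q using Quot.ind with | mk M => ?_
  exact ⟨Quot.mk _ M, rfl⟩

omit [Nonempty ι] in
/-- **`#W̄k(S) = 1` iff the stratum is nonempty and all its ideals are pairwise weakly equivalent.**
[cite: Marseglia2019, §4 («`W̄k(S) = {[S]}` if and only if `S` is Gorenstein»), p. 8] -/
theorem natCard_quot_stratum_weak_eq_one_iff (S : Subring K) :
    Nat.card (Quot fun M N : {M : FractionalIdeal (endOrder ρ)⁰ K //
        M ≠ 0 ∧ ((M / M : FractionalIdeal (endOrder ρ)⁰ K) : Set K) = S} =>
      (1 : K) ∈ (M : FractionalIdeal (endOrder ρ)⁰ K) / N * (N / M)) = 1 ↔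
    (∃ M : FractionalIdeal (endOrder ρ)⁰ K, M ≠ 0 ∧ ((M / M : FractionalIdeal (endOrder ρ)⁰ K) : Set K) = S) ∧
      ∀ M N : FractionalIdeal (endOrder ρ)⁰ K, M ≠ 0 → ((M / M : FractionalIdeal (endOrder ρ)⁰ K) : Set K) = S →
        N ≠ 0 → ((N / N : FractionalIdeal (endOrder ρ)⁰ K) : Set K) = S → (1 : K) ∈ M / N * (N / M) := by
  rw [Nat.card_eq_one_iff_unique]
  constructor
  · rintro ⟨hsub, ⟨q⟩⟩
    refine ⟨?_, fun M N hM hMS hN hNS => ?_⟩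
    · induction q using Quot.ind with | mk M => ?_
      exact ⟨M.1, M.2⟩
    · have h := hsub.elim (Quot.mk _ ⟨M, hM, hMS⟩) (Quot.mk _ ⟨N, hN, hNS⟩)
      exact (equivalence_one_mem_div_mul_div (fun M : FractionalIdeal (endOrder ρ)⁰ K =>
        M ≠ 0 ∧ ((M / M : FractionalIdeal (endOrder ρ)⁰ K) : Set K) = S) (fun M h => h.1)).eqvGen_iff.1 (Quot.eqvGen_exact h)
  · rintro ⟨⟨M, hM, hMS⟩, hwk⟩
    refine ⟨⟨fun a b => ?_⟩, ⟨Quot.mk _ ⟨M, hM, hMS⟩⟩⟩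
    induction a using Quot.ind with | mk I => ?_
    induction b using Quot.ind with | mk J => ?_
    exact Quot.sound (hwk I.1 J.1 I.2.1 I.2.2 J.2.1 J.2.2)

end AnyOrder

end EndOrder

namespace CMTypeLattice

section Gorenstein

variable {K : Type} [Field K] [NumberField K]
variable {ι : Type} [Fintype ι] [DecidableEq ι] [Nonempty ι] (μ : Basis ι ℚ K)
variable [IsFractionRing (endOrder (Algebra.leftMulMatrix μ)) K]

/-! ## §2 `S` is Gorenstein ⟺ `#W̄k(S) = 1` ⟺ `#ICM_S = #Pic(S)`; otherwise `[S] ≠ [Sᵗ]` and `#W̄k(S) ≥ 2` -/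

omit [Nonempty ι] in
/-- The stratum of the over-order `M = MM ≠ 0` (`↑M = S`): `I` belongs to it iff `I ≠ 0` and `(I:I) = M`
(bookkeeping between the `Set K` index and the idempotent). [cite: Marseglia2019, §4 («`ICM_S = {[I] : (I:I) = S}`»), p. 9] -/
theorem coe_div_self_eq_iff_div_self_eq {M I : FractionalIdeal (endOrder (Algebra.leftMulMatrix μ))⁰ K}
    {S : Subring K} (hMS : (M : Set K) = S) :
    ((I / I : FractionalIdeal (endOrder (Algebra.leftMulMatrix μ))⁰ K) : Set K) = S ↔ I / I = M := by
  rw [← hMS]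
  exact ⟨fun h => SetLike.coe_injective h, fun h => by rw [h]⟩

/-- **«`W̄k(S) = {[S]}` if and only if `S` is Gorenstein», COUNTED: `#W̄k(S) = 1 ⟺ (M:(M:I)) = I` for every
`M`-ideal `I ≠ 0`** (`M = MM ≠ 0` the over-order with `↑M = S`). [cite: Marseglia2019, §4 (after Def. 4.2), p. 8]
[cite: BuchmannLenstra1994, §2 Prop. 2.7, p. 230] -/
theorem natCard_quot_stratum_weak_eq_one_iff_forall_div_div_eq {M : FractionalIdeal (endOrder (Algebra.leftMulMatrix μ))⁰ K}
    (hMM : M * M = M) (hM0 : M ≠ 0) {S : Subring K} (hMS : (M : Set K) = S) :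
    Nat.card (Quot fun I N : {I : FractionalIdeal (endOrder (Algebra.leftMulMatrix μ))⁰ K //
        I ≠ 0 ∧ ((I / I : FractionalIdeal (endOrder (Algebra.leftMulMatrix μ))⁰ K) : Set K) = S} =>
      (1 : K) ∈ (I : FractionalIdeal (endOrder (Algebra.leftMulMatrix μ))⁰ K) / N * (N / I)) = 1 ↔
    ∀ I : FractionalIdeal (endOrder (Algebra.leftMulMatrix μ))⁰ K, I ≠ 0 → M * I = I → M / (M / I) = I := by
  have hMMS : ((M / M : FractionalIdeal (endOrder (Algebra.leftMulMatrix μ))⁰ K) : Set K) = S := by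
    rw [EndOrder.div_self_eq_of_mul_self_eq_endOrder hM0 hMM, hMS]
  have hmem : ∀ {I : FractionalIdeal (endOrder (Algebra.leftMulMatrix μ))⁰ K}, I ≠ 0 →
      ((I / I : FractionalIdeal (endOrder (Algebra.leftMulMatrix μ))⁰ K) : Set K) = S → M * I = I := fun {I} hI h => by
    have hII : I / I = M := (coe_div_self_eq_iff_div_self_eq μ hMS).1 h
    rw [← hII, EndOrder.div_self_mul_self_eq hI]
  rw [EndOrder.natCard_quot_stratum_weak_eq_one_iff, ← forall_one_mem_div_mul_div_iff_forall_div_div_eq μ hMM hM0]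
  constructor
  · rintro ⟨-, hwk⟩ I hI hMI hII
    exact hwk I M hI ((coe_div_self_eq_iff_div_self_eq μ hMS).2 hII) hM0 hMMS
  · intro h
    refine ⟨⟨M, hM0, hMMS⟩, fun I N hI hIS hN hNS => ?_⟩
    have hI1 := h I hI (hmem hI hIS) ((coe_div_self_eq_iff_div_self_eq μ hMS).1 hIS)
    have hN1 := h N hN (hmem hN hNS) ((coe_div_self_eq_iff_div_self_eq μ hMS).1 hNS)
    exact EndOrder.one_mem_div_mul_div_trans hI hM0 hN hI1 (by rw [mul_comm]; exact hN1)

/-- **«when `S` is not Gorenstein there are always at least two distinct classes in `W̄k(S)`, namely `[S]` and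
`[Sᵗ]`»**: `M` and `Mᵗ` are weakly equivalent iff `M` is Gorenstein (`Mᵗ ~ M ⟺ Mᵗ` invertible in `M`, PROP. 2.7 (c)).
[cite: Marseglia2019, §5 (first remark), p. 10] [cite: BuchmannLenstra1994, §2 Prop. 2.7 ((a)⟺(c)), p. 230] -/
theorem one_mem_traceDual_div_mul_div_iff_forall_div_div_eq {M TM : FractionalIdeal (endOrder (Algebra.leftMulMatrix μ))⁰ K}
    (hMM : M * M = M) (hM0 : M ≠ 0) (hTM0 : TM ≠ 0)
    (hTM : (TM : Submodule (endOrder (Algebra.leftMulMatrix μ)) K) =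
      traceDual ℤ ℚ (M : Submodule (endOrder (Algebra.leftMulMatrix μ)) K)) :
    (1 : K) ∈ TM / M * (M / TM) ↔
      ∀ I : FractionalIdeal (endOrder (Algebra.leftMulMatrix μ))⁰ K, I ≠ 0 → M * I = I → M / (M / I) = I := by
  haveI := isNoetherianRing_endOrder (Algebra.leftMulMatrix μ)
  rw [EndOrder.one_mem_div_mul_div_iff_mul_div_eq hMM hM0 hTM0
      (mul_eq_of_coe_eq_traceDual μ hMM (EndOrder.one_mem_of_mul_self_eq hM0 hMM) hTM),
    forall_div_div_eq_iff_traceDual_mul_div_eq μ hMM hM0 hTM0 hTM]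

/-- **Non-Gorenstein over-orders have `#W̄k(S) ≥ 2`** (the classes of `S` and `Sᵗ` are distinct).
[cite: Marseglia2019, §5 (first remark: «at least two distinct classes in `W̄k(S)`, namely `[S]` and `[Sᵗ]`»), p. 10] -/
theorem two_le_natCard_quot_stratum_weak_of_not_forall_div_div_eq {M : FractionalIdeal (endOrder (Algebra.leftMulMatrix μ))⁰ K}
    (hMM : M * M = M) (hM0 : M ≠ 0) {S : Subring K} (hMS : (M : Set K) = S)
    (hnot : ¬ ∀ I : FractionalIdeal (endOrder (Algebra.leftMulMatrix μ))⁰ K, I ≠ 0 → M * I = I → M / (M / I) = I) :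
    2 ≤ Nat.card (Quot fun I N : {I : FractionalIdeal (endOrder (Algebra.leftMulMatrix μ))⁰ K //
        I ≠ 0 ∧ ((I / I : FractionalIdeal (endOrder (Algebra.leftMulMatrix μ))⁰ K) : Set K) = S} =>
      (1 : K) ∈ (I : FractionalIdeal (endOrder (Algebra.leftMulMatrix μ))⁰ K) / N * (N / I)) := by
  haveI := EndOrder.finite_quot_stratum_weak (ρ := Algebra.leftMulMatrix μ) (K := K) S
  obtain ⟨TM, hTM0, hTM⟩ := exists_coe_eq_traceDual μ hM0
  have hMMS : ((M / M : FractionalIdeal (endOrder (Algebra.leftMulMatrix μ))⁰ K) : Set K) = S := by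
    rw [EndOrder.div_self_eq_of_mul_self_eq_endOrder hM0 hMM, hMS]
  have hTMS : ((TM / TM : FractionalIdeal (endOrder (Algebra.leftMulMatrix μ))⁰ K) : Set K) = S := by
    rw [traceDual_div_traceDual_eq_of_mul_self_eq μ hMM hM0 hTM0 hTM, hMS]
  -- `[Sᵗ] ≠ [S]` in `W̄k(S)`
  have hne : Quot.mk (fun I N : {I : FractionalIdeal (endOrder (Algebra.leftMulMatrix μ))⁰ K //
        I ≠ 0 ∧ ((I / I : FractionalIdeal (endOrder (Algebra.leftMulMatrix μ))⁰ K) : Set K) = S} =>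
      (1 : K) ∈ (I : FractionalIdeal (endOrder (Algebra.leftMulMatrix μ))⁰ K) / N * (N / I)) ⟨TM, hTM0, hTMS⟩ ≠
      Quot.mk _ ⟨M, hM0, hMMS⟩ := fun h =>
    hnot ((one_mem_traceDual_div_mul_div_iff_forall_div_div_eq μ hMM hM0 hTM0 hTM).1
      ((EndOrder.equivalence_one_mem_div_mul_div (fun I : FractionalIdeal (endOrder (Algebra.leftMulMatrix μ))⁰ K =>
        I ≠ 0 ∧ ((I / I : FractionalIdeal (endOrder (Algebra.leftMulMatrix μ))⁰ K) : Set K) = S) (fun I h => h.1)).eqvGen_iff.1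
        (Quot.eqvGen_exact h)))
  have h1 : 1 < Nat.card (Quot fun I N : {I : FractionalIdeal (endOrder (Algebra.leftMulMatrix μ))⁰ K //
        I ≠ 0 ∧ ((I / I : FractionalIdeal (endOrder (Algebra.leftMulMatrix μ))⁰ K) : Set K) = S} =>
      (1 : K) ∈ (I : FractionalIdeal (endOrder (Algebra.leftMulMatrix μ))⁰ K) / N * (N / I)) :=
    (Finite.one_lt_card_iff_nontrivial).2 ⟨⟨_, _, hne⟩⟩
  omega

/-- **`S` is Gorenstein ⟺ `#ICM_S(𝔯) = #Pic(S)`** — the stratum of a Gorenstein over-order is ONE `Pic(S)`-torsor, and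
conversely (THM. 4.6: `#ICM_S = #W̄k(S)·#Pic(S)` with `#Pic(S) ≥ 1`). [cite: Marseglia2019, §4 Thm. 4.6 with the remark
after Def. 4.2, pp. 8–9] -/
theorem natCard_quot_stratum_eq_natCard_quot_pic_iff_forall_div_div_eq {M : FractionalIdeal (endOrder (Algebra.leftMulMatrix μ))⁰ K}
    (hMM : M * M = M) (hM0 : M ≠ 0) {S : Subring K} (hMS : (M : Set K) = S) :
    Nat.card (Quot fun I N : {I : FractionalIdeal (endOrder (Algebra.leftMulMatrix μ))⁰ K //
        I ≠ 0 ∧ ((I / I : FractionalIdeal (endOrder (Algebra.leftMulMatrix μ))⁰ K) : Set K) = S} =>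
      ∃ x : K, x ≠ 0 ∧ (I : FractionalIdeal (endOrder (Algebra.leftMulMatrix μ))⁰ K) =
        spanSingleton (endOrder (Algebra.leftMulMatrix μ))⁰ x * N) =
    Nat.card (Quot fun L N : {L : FractionalIdeal (endOrder (Algebra.leftMulMatrix μ))⁰ K //
        (L ≠ 0 ∧ ((L / L : FractionalIdeal (endOrder (Algebra.leftMulMatrix μ))⁰ K) : Set K) = S) ∧ L * (L / L / L) = L / L} =>
      ∃ x : K, x ≠ 0 ∧ (L : FractionalIdeal (endOrder (Algebra.leftMulMatrix μ))⁰ K) =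
        spanSingleton (endOrder (Algebra.leftMulMatrix μ))⁰ x * N) ↔
    ∀ I : FractionalIdeal (endOrder (Algebra.leftMulMatrix μ))⁰ K, I ≠ 0 → M * I = I → M / (M / I) = I := by
  have hMMS : ((M / M : FractionalIdeal (endOrder (Algebra.leftMulMatrix μ))⁰ K) : Set K) = S := by
    rw [EndOrder.div_self_eq_of_mul_self_eq_endOrder hM0 hMM, hMS]
  rw [← natCard_quot_stratum_weak_eq_one_iff_forall_div_div_eq μ hMM hM0 hMS,
    EndOrder.natCard_quot_stratum_eq_natCard_quot_weak_mul_natCard_quot_pic S]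
  -- `#Pic(S) ≠ 0`: the class of `M` itself (finite quotient, nonempty)
  haveI : Finite (Quot fun L N : {L : FractionalIdeal (endOrder (Algebra.leftMulMatrix μ))⁰ K //
        (L ≠ 0 ∧ ((L / L : FractionalIdeal (endOrder (Algebra.leftMulMatrix μ))⁰ K) : Set K) = S) ∧ L * (L / L / L) = L / L} =>
      ∃ x : K, x ≠ 0 ∧ (L : FractionalIdeal (endOrder (Algebra.leftMulMatrix μ))⁰ K) =
        spanSingleton (endOrder (Algebra.leftMulMatrix μ))⁰ x * N) := by
    haveI := EndOrder.finite_quot_stratum (ρ := Algebra.leftMulMatrix μ) (K := K) S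
    refine Finite.of_injective (Quot.lift (fun L => Quot.mk (fun I N : {I : FractionalIdeal (endOrder (Algebra.leftMulMatrix μ))⁰ K //
        I ≠ 0 ∧ ((I / I : FractionalIdeal (endOrder (Algebra.leftMulMatrix μ))⁰ K) : Set K) = S} =>
      ∃ x : K, x ≠ 0 ∧ (I : FractionalIdeal (endOrder (Algebra.leftMulMatrix μ))⁰ K) =
        spanSingleton (endOrder (Algebra.leftMulMatrix μ))⁰ x * N) ⟨L.1, L.2.1⟩) fun L N h => Quot.sound h) ?_
    intro q₁ q₂ h
    induction q₁ using Quot.ind with | mk L => ?_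
    induction q₂ using Quot.ind with | mk N => ?_
    have h' : Quot.mk (fun I N : {I : FractionalIdeal (endOrder (Algebra.leftMulMatrix μ))⁰ K //
        I ≠ 0 ∧ ((I / I : FractionalIdeal (endOrder (Algebra.leftMulMatrix μ))⁰ K) : Set K) = S} =>
      ∃ x : K, x ≠ 0 ∧ (I : FractionalIdeal (endOrder (Algebra.leftMulMatrix μ))⁰ K) =
        spanSingleton (endOrder (Algebra.leftMulMatrix μ))⁰ x * N) ⟨L.1, L.2.1⟩ = Quot.mk _ ⟨N.1, N.2.1⟩ := h
    exact Quot.sound ((EndOrder.equivalence_exists_eq_spanSingleton_mul fun I : FractionalIdeal (endOrder (Algebra.leftMulMatrix μ))⁰ K =>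
      I ≠ 0 ∧ ((I / I : FractionalIdeal (endOrder (Algebra.leftMulMatrix μ))⁰ K) : Set K) = S).eqvGen_iff.1 (Quot.eqvGen_exact h'))
  have hP0 : Nat.card (Quot fun L N : {L : FractionalIdeal (endOrder (Algebra.leftMulMatrix μ))⁰ K //
        (L ≠ 0 ∧ ((L / L : FractionalIdeal (endOrder (Algebra.leftMulMatrix μ))⁰ K) : Set K) = S) ∧ L * (L / L / L) = L / L} =>
      ∃ x : K, x ≠ 0 ∧ (L : FractionalIdeal (endOrder (Algebra.leftMulMatrix μ))⁰ K) =
        spanSingleton (endOrder (Algebra.leftMulMatrix μ))⁰ x * N) ≠ 0 := by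
    have hMPic : M * (M / M / M) = M / M := by
      rw [EndOrder.div_self_eq_of_mul_self_eq_endOrder hM0 hMM, EndOrder.div_self_eq_of_mul_self_eq_endOrder hM0 hMM, hMM]
    haveI : Nonempty (Quot fun L N : {L : FractionalIdeal (endOrder (Algebra.leftMulMatrix μ))⁰ K //
        (L ≠ 0 ∧ ((L / L : FractionalIdeal (endOrder (Algebra.leftMulMatrix μ))⁰ K) : Set K) = S) ∧ L * (L / L / L) = L / L} =>
      ∃ x : K, x ≠ 0 ∧ (L : FractionalIdeal (endOrder (Algebra.leftMulMatrix μ))⁰ K) =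
        spanSingleton (endOrder (Algebra.leftMulMatrix μ))⁰ x * N) := ⟨Quot.mk _ ⟨M, ⟨hM0, hMMS⟩, hMPic⟩⟩
    exact Nat.card_pos.ne'
  exact mul_eq_right₀ hP0

end Gorenstein

end CMTypeLattice

end Literature.NumberTheory.ComplexMultiplication
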